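import Mathlib

/-!
# SoloBlind — exponent bookkeeping for the squared Chowla–Selberg relation (CS²)

Finite certificates (all `decide`) behind the s31 theorem-candidate CS² of
`paper/weil-transport.md` §4.6 (solo-blind programme on the Kontsevich–Zagier conjecture).

For an odd prime level `M`, a Fermat triple `(a, b, c)` with `a + b + c ≡ 0 (mod M)` and the
quadratic character `χ` of conductor `M`, the Weil-ratio relation (W₀) at Gross's CM point reads
`∏_{χ(u)=+1} B_u · q̃^m = κ · ∏_{χ(u)=-1} B_u · Ω^m`, `m = r - s`, where
`B_u = B(⟨ua⟩/M, ⟨ub⟩/M)` and `r`, `s` count `χ = ±1` on the CM type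
`Φ = {u : ⟨ua⟩ + ⟨ub⟩ + ⟨uc⟩ = M}`.  Up to rational factors the Γ-exponent vector of
`∏_u B_u^{χ(u)}` is `betaChiVec M a b : k ↦ Σ_u χ(u)([⟨ua⟩ = k] + [⟨ub⟩ = k] - [⟨u(a+b)⟩ = k])`,
and the classical Chowla–Selberg vector is `k ↦ χ(k)`.

* `cs2_exact_7/11/19`, `cs2_exact_43_sample`: for the class-number-one levels 7, 11, 19 (all
  triples) and 43 (two sample triples) the two vectors agree EXACTLY: `betaChiVec = (r - s) • χ`.
* `cs2_koUnit_23_sample`: at level 23 (class number 3) they do not agree exactly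
  (`cs2_notExact_23`), but `3 • betaChiVec - (r - s) • χ` is a Koblitz–Ogus unit vector:
  all the sums `Σ_k q_k ⟨wk⟩`, `w` a unit, vanish.

These are the combinatorial identities asserting that (W₀)/CS² is the `m`-th power of the
classical Chowla–Selberg formula (times a Koblitz–Ogus unit when `h > 1`).
-/

namespace Summit.KontsevichZagierPeriods.KontsevichZagierPeriods.Theorems
namespace SoloBlind

/-- Quadratic-residue character at an odd prime `p` (values in `ℤ`; `0` on multiples of `p`). -/
def chiQ (p u : ℕ) : ℤ :=
  if u % p = 0 then 0
  else if (List.range p).any (fun x => x * x % p == u % p) then 1 else -1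

/-- Membership of the unit `u` in the CM type `Φ_{a,b}` of level `M`. -/
def inCMType (M a b u : ℕ) : Bool :=
  (u * a % M) + (u * b % M) + (u * (M - (a + b) % M) % M) == M

/-- `r - s = Σ_{u ∈ Φ} χ(u)`. -/
def typeDefect (M a b : ℕ) : ℤ :=
  ((List.range M).filter (fun u => inCMType M a b u)).foldr (fun u acc => chiQ M u + acc) 0

/-- `k`-th entry (`1 ≤ k < M`) of the χ-twisted Beta exponent vector `Σ_u χ(u) β_u(a,b)`. -/
def betaChiEntry (M a b k : ℕ) : ℤ :=
  (List.range M).foldr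
    (fun u acc =>
      chiQ M u * ((if u * a % M = k then 1 else 0) + (if u * b % M = k then 1 else 0)
                   - (if u * (a + b) % M = k then 1 else 0)) + acc) 0

/-- The χ-twisted Beta exponent vector, entries `k = 1, …, M-1`. -/
def betaChiVec (M a b : ℕ) : List ℤ :=
  ((List.range M).filter (fun k => k ≠ 0)).map (fun k => betaChiEntry M a b k)

/-- `(r - s)` times the Chowla–Selberg vector `k ↦ χ(k)`, entries `k = 1, …, M-1`. -/
def csVecScaled (M a b : ℕ) : List ℤ :=
  ((List.range M).filter (fun k => k ≠ 0)).map (fun k => typeDefect M a b * chiQ M k)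

/-- Admissible pairs `(a, b)`: `1 ≤ a ≤ b`, `a + b ≢ 0 (mod M)` (then `c = M - (a+b) mod M`). -/
def admissiblePairs (M : ℕ) : List (ℕ × ℕ) :=
  ((List.range M).filter (fun a => a ≠ 0)).flatMap fun a =>
    (((List.range M).filter (fun b => a ≤ b ∧ (a + b) % M ≠ 0)).map fun b => (a, b))

/-- Koblitz–Ogus sums `Σ_k q_k · ⟨w k⟩` of an exponent vector `q` (entries `k = 1..M-1`). -/
def koSum (M : ℕ) (q : List ℤ) (w : ℕ) : ℤ :=
  ((List.range (M - 1)).zip q).foldr (fun kq acc => kq.2 * (((kq.1 + 1) * w % M : ℕ) : ℤ) + acc) 0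

/-- Level 7: exact agreement for every triple. -/
theorem cs2_exact_7 :
    (admissiblePairs 7).all (fun ab => betaChiVec 7 ab.1 ab.2 == csVecScaled 7 ab.1 ab.2) = true := by
  decide

set_option maxRecDepth 16384 in
/-- Level 11: exact agreement `Σ_u χ(u) β_u = (r-s)·χ` for every triple. -/
theorem cs2_exact_11 :
    (admissiblePairs 11).all (fun ab => betaChiVec 11 ab.1 ab.2 == csVecScaled 11 ab.1 ab.2) = true := by
  decide

set_option maxHeartbeats 4000000 in
set_option maxRecDepth 65536 in
/-- Level 19 (the smallest non-dominated field ℚ(√-19)): exact agreement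
`Σ_u χ(u) β_u = (r-s)·χ` for every triple. -/
theorem cs2_exact_19 :
    (admissiblePairs 19).all
      (fun ab => betaChiVec 19 ab.1 ab.2 == csVecScaled 19 ab.1 ab.2) = true := by
  decide

set_option maxRecDepth 65536 in
/-- Level 19, the four test triples of the numerics job: `(1,2,16)`, `(1,4,14)` have `r - s = 1`,
`(1,1,17)` has `r - s = 3`, `(1,3,15)` has `r - s = -1`. -/
theorem typeDefect_19 :
    typeDefect 19 1 2 = 1 ∧ typeDefect 19 1 4 = 1 ∧ typeDefect 19 1 1 = 3 ∧ typeDefect 19 1 3 = -1 := by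
  decide

set_option maxRecDepth 65536 in
/-- Level 43: exact agreement for the sample triples `(1,1,41)`, `(1,2,40)`. -/
theorem cs2_exact_43_sample :
    betaChiVec 43 1 1 = csVecScaled 43 1 1 ∧ betaChiVec 43 1 2 = csVecScaled 43 1 2 := by
  decide

set_option maxRecDepth 65536 in
/-- Level 23 (class number 3): the vectors do NOT agree exactly for `(1,1,21)`. -/
theorem cs2_notExact_23 : betaChiVec 23 1 1 ≠ csVecScaled 23 1 1 := by
  decide

set_option maxRecDepth 65536 in
/-- Level 23: `q = 3·betaChiVec - (r-s)·χ` is a Koblitz–Ogus unit vector (all unit sums vanish)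
for the sample triples `(1,1,21)` and `(1,2,20)`. -/
theorem cs2_koUnit_23_sample :
    ((List.range 23).filter (fun w => w ≠ 0)).all (fun w =>
        koSum 23 ((betaChiVec 23 1 1).zipWith (fun x y => 3 * x - y) (csVecScaled 23 1 1)) w == 0
        && koSum 23 ((betaChiVec 23 1 2).zipWith (fun x y => 3 * x - y) (csVecScaled 23 1 2)) w == 0)
      = true := by
  decide

end SoloBlind
end Summit.KontsevichZagierPeriods.KontsevichZagierPeriods.Theorems
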